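import Summits.QuantumFields.BalabanUV.Beta.FP.HorizontalBookkeepingEnd
import Summits.QuantumFields.BalabanUV.Beta.FP.TruncatedZerothMoment
import Summits.QuantumFields.BalabanUV.Beta.FP.HorizontalBookkeepingDefectLetters

/-!
# `BalabanUV.Beta.FP.HorizontalBookkeepingLetters` — road «FP» for binder row D1, row N7/H3-BOOK: THE BOOKKEEPING BOUND FROM THE ROAD's NAMED
# LETTERS AND NOTHING ELSE — (H1) at kernel level, the transport letters (Kronecker masses, (L1∞), `AbsMoment₂`, sup profile p = 5), the kernel letters
# (sextic decay, septic differences, evenness, the Ward ∕ (T0) letter `HasSum (K c e) 0`), and the log-asymptotics `hgerm` of the window function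

HONEST DEPENDENCY (page 1, mandatory): continuum YM on T⁴ ⇐ BetaPertH ∧ nine spine estimates (0/9 proved); BetaPertH ⇐ (D1) ∧ (D4) ∧
CAP+tail; G-an2-4 gates asym, D1 and NE2/3/4.  HONEST FRAMING (cell contract, verbatim): «discharging `BetaPertH` makes Bałaban's UV
stability UNCONDITIONAL — a real constructive-QFT result; it is NOT the continuum limit and NOT the Clay problem.»  THIS MODULE is [folklore]
composition BY NAME: `FP/HorizontalBookkeepingEnd.abs_secondMoment_sub_window_le_of_letters` (leaf-05-g8) with its `hU0` input DISCHARGED by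
leaf-02-g6's `FP/HorizontalBookkeepingDefectLetters.pow_six_mul_abs_t0Defect_le_of_supProfile` fed by leaf-05-g8's
`FP/TruncatedZerothMoment.abs_tsum_truncK_le_of_hasSum_zero` (`A := 40·C`).  No `def`, no `Prop` fact, no cite, 0 `sorry`.  EVERY remaining hypothesis is one
of road FP's NAMED LETTERS (suppliers: H1-KER = the shared composition lane; IPROF-UNIF ∕ `TransportInfinityM` for the transport letters; H2-OBJ (owner) for the
kernel letters incl. transversality `HasSum (K c e) 0` and for `hgerm`).  FINDING F-d1leaf05g8-1: `hgerm` is necessary.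
NOT hbook-discharged (its letters are open), NOT hasym, NOT D1, NOT BetaPertH, NOT continuum, NOT Clay.

ABSOLUTE RULE (cell charter, verbatim): «No internally-minted statement may enter as a cited fact. Every hypothesis is either kernel-proved in this
package or a verbatim quotation of a PUBLISHED theorem with page reference. The manuscript(s) under audit are NOT citable for their own disputed
steps — they are the thing under adjudication; programme-internal (2001/route/tribunal) claims are never citable.»

THE STATEMENT (`abs_secondMoment_sub_window_le_of_supProfile`): for every `N ≥ 1`,
`|secondMoment T μ ν − Σ_{0<‖z‖∞≤N} K μ ν z·z_μ·z_ν| ≤ U₀(C,c,δ) + 161·A_T(C,c,δ) + (3·Cg + 67392·C) + |c₀|` with the two DISPLAYED N-free constants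
`U₀ = 16·(40C)·(2·c₂ + 2·c₁·c₁)` (`c₂ = 2c·e^{δ/2}(2/δ)²(1+4/δ)⁴`, `c₁ = c·e^{δ/2}(2/δ)(1+4/δ)⁴`) and `A_T` (leaf-02-g6's transport constant).
Provenance: D1 formalisation swarm, unit b2b-balaban-beta-d1-formalise-leaf-05 gen 8 (prover-b2b-balaban-beta-d1-formalise-leaf-05-g8-0), 2026-08-20.
-/

noncomputable section

namespace Summit.QuantumFields.BalabanUV.Beta.FP.HorizontalBookkeepingLetters

open Finset Filter Topology
open Literature.Probability.LatticeModels (box annulus)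
open Literature.MathematicalPhysics.QuantumFieldTheory.Balaban1983to89
open Literature.MathematicalPhysics.QuantumFieldTheory.Balaban1983to89.Beta
open B12Sec2to5 (l1)
open DyadicShell (Pt supNorm)
open DecimatedMomentSummable (ConstReproSum LinReproSum AbsMoment₂)
open DressedMomentNormalisation (EKer dressedEntry)
open Summit.QuantumFields.BalabanUV.Beta.FP.HorizontalBookkeeping (truncK)
open Summit.QuantumFields.BalabanUV.Beta.FP.HorizontalBookkeepingEnd (abs_secondMoment_sub_window_le_of_letters)
open Summit.QuantumFields.BalabanUV.Beta.FP.TruncatedZerothMoment (abs_tsum_truncK_le_of_hasSum_zero)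
open Summit.QuantumFields.BalabanUV.Beta.FP.HorizontalBookkeepingDefectLetters (pow_six_mul_abs_t0Defect_le_of_supProfile)

/-- [folklore] **THE HORIZONTAL BOOKKEEPING BOUND FROM THE NAMED LETTERS.**  See the module docstring. -/
theorem abs_secondMoment_sub_window_le_of_supProfile {K w : EKer 4} {C c δ : ℝ} {N : ℕ} (hN : 1 ≤ N) (hδ : 0 < δ) (hc : 0 ≤ c)
    -- kernel letters (incl. the Ward ∕ (T0) letter of the FULL kernel)
    (hK : ∀ c' e (t : Pt), |K c' e t| ≤ C / ((supNorm t : ℝ) + 1) ^ 6)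
    (hdK : ∀ c' e (t : Pt) (i : Fin 4), |K c' e (t + Pi.single i 1) - K c' e t| ≤ C / ((supNorm t : ℝ) + 1) ^ 7)
    (heven : ∀ c' e (t : Pt), K c' e (-t) = K c' e t)
    (hK0 : ∀ c' e, HasSum (K c' e) 0)
    -- transport letters
    (Cw : Fin 4 → Fin 4 → Fin 4 → ℝ)
    (hw0 : ∀ κ l, ConstReproSum N (w κ l) (if κ = l then (((N : ℝ) ^ (4 + 1))⁻¹) else 0))
    (hw1 : ∀ κ l, LinReproSum N (w κ l) (Cw κ l)) (hwA : ∀ κ l, AbsMoment₂ (w κ l))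
    (hw : ∀ κ l x, |w κ l x| ≤ c / (N : ℝ) ^ 5 * Real.exp (-(δ / N) * l1 x))
    -- (H1) at kernel level for the transported kernel, channel `(μ, ν)`
    {T D : EKer 4} (μ ν : Fin 4)
    (hH1 : ∀ v : Pt, (N : ℝ) ^ 8 * dressedEntry w K ((N : ℤ) • v) μ ν = T μ ν v + K μ ν v + D μ ν v)
    (hT : Summable fun v : Pt => T μ ν v * (v μ : ℝ) * (v ν : ℝ))
    (hD : HasSum (fun v : Pt => D μ ν v * (v μ : ℝ) * (v ν : ℝ)) 0)
    -- the log-asymptotics letter of the window function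
    {s c₀ Cg : ℝ}
    (hgerm : ∀ M : ℕ, 1 ≤ M → |∑ z ∈ annulus 4 0 M, K μ ν z * (z μ : ℝ) * (z ν : ℝ) - (s * Real.log M + c₀)| ≤ Cg) :
    let U₀ : ℝ := 16 * (40 * C) * (2 * ((2 * c * Real.exp (δ / 2) * (2 / δ) ^ 2 * (1 + 4 / δ) ^ 4))
          + 2 * (c * (Real.exp (δ / 2) * (2 / δ) * (1 + 4 / δ) ^ 4)) * (c * Real.exp (δ / 2) * (2 / δ) * (1 + 4 / δ) ^ 4))
    let AT : ℝ := (4 : ℝ) ^ 7 * (16 * C * c ^ 2 * (Real.exp (δ / 2) * (1 + 4 / δ) ^ 4) ^ 2 + C)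
          + (5 / 4 : ℝ) ^ 7 * (C * c ^ 2 * Real.exp (δ / 2) ^ 2 * (1 + 4 / δ) ^ 8
              * (128 * (4 / 3 : ℝ) ^ 7 * (2 / δ) + 4096 * 16 ^ 7 * 5040 * (2 / δ) ^ 7))
    |B12Beta.secondMoment T μ ν - ∑ z ∈ annulus 4 0 N, K μ ν z * (z μ : ℝ) * (z ν : ℝ)|
      ≤ U₀ + 161 * AT + (3 * Cg + 67392 * C) + |c₀| := by
  intro U₀ AT
  -- nonnegativity of the kernel constant
  have hC : 0 ≤ C := by
    have h := hK μ ν 0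
    have h0 : (supNorm (0 : Pt) : ℝ) = 0 := by rw [DyadicShell.supNorm_eq_zero_iff.mpr rfl]; simp
    rw [h0, zero_add, one_pow, div_one] at h
    exact (abs_nonneg _).trans h
  -- the (T0)-smallness of the truncation from the Ward letter, then the defect size from the profile letters
  have hA : ∀ c' e, |∑' t : Pt, truncK K N c' e t| ≤ 40 * C / (N : ℝ) ^ 2 :=
    fun c' e => abs_tsum_truncK_le_of_hasSum_zero hC c' e (hK c' e) (hK0 c' e) hN
  have hU0 : (N : ℝ) ^ 6 * |HorizontalBookkeeping.t0Defect N w (truncK K N) Cw μ ν μ ν| ≤ U₀ :=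
    pow_six_mul_abs_t0Defect_le_of_supProfile hN hδ hc hw1 hw hA μ ν μ ν
  exact abs_secondMoment_sub_window_le_of_letters hN hδ hc hK hdK heven Cw hw0 hw1 hwA hw μ ν hH1 hT hD hU0 hgerm

end Summit.QuantumFields.BalabanUV.Beta.FP.HorizontalBookkeepingLetters

end
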